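import Mathlib
import Summits.QuantumFields.YangMills.Theorems.TransportFieldVacuumDerivativeLinear
import Summits.QuantumFields.YangMills.Theorems.FemtoTransferGapSlabFlowLift
import HarnessLib

/-!
# Transport-field regularity kit, tranche 5: direction-`0` Polyakov lines and the torelon deviation `F` along right `expPauli` shifts

For ⟨stmt-QuantumFields-23355⟩ `TransportFieldFano.RobertsonInequality` (and `stub_robertsonB` ⟨23380⟩, `stub_transportDerivative` ⟨23352⟩):
the observables there are cylinder functions of the direction-`0` Polyakov holonomies `lineHolonomy U 0 L y`, which DO contain the shifted link
`(x,0)`.  Along the right shift `U ↦ U[e ↦ U_e expPauli(t a(U))]` with a continuous direction field `a`: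
* `hasDerivAt_su2Rep_update_link` — one link factor: derivative `U_e · su2Coord(a)` at the shifted link, `0` elsewhere;
* `exists_hasDerivAt_lineHolonomy` — every straight-line holonomy (as a matrix) is differentiable at `t = 0`, with a derivative that is a
  CONTINUOUS function of the configuration (product rule along the word, induction on the length);
* `exists_hasDerivAt_torelonDev` — hence so is the site-averaged direction-`0` torelon deviation `F = (1/|Λ|)Σ_y (4 − (Re tr P₀(y))²)`;
* `lineHolonomy_update_offline`, `torelonDev_flow`, `lipschitz_torelonDev_flow` — for an `e`-BLIND direction field the shift is a flow, and `F` is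
  Lipschitz along it (bounded continuous derivative on the compact configuration space).
HONEST FRAMING: fixed-lattice calculus; no claim about the cruxes, K2a or the YM mass gap.  No `sorry`, no new axiom, no new definition.
References: [cite: Creutz2022, Ch. 11]; [cite: Balaban1985UV3, p. 260].
-/

set_option autoImplicit false

noncomputable section

open MeasureTheory Filter Topology NormedSpace
open scoped BigOperators Matrix.Norms.Frobenius
open Literature.MathematicalPhysics.QuantumFieldTheory (GaugeConfig Site Edge lineHolonomy)
open Literature.MathematicalPhysics.QuantumLattice (secondCountableTopology_su2)
open Literature.MathematicalPhysics.QuantumFieldTheory.Balaban1983to89.B10Eq18SigmaSU2 (su2Coord)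
open Literature.MathematicalPhysics.QuantumFieldTheory.Balaban1983to89.B10Eq18SigmaSU2Haar (expPauli expPauli_zero)
open Summit.QuantumFields.YangMills.Cruxes.CurvatureAmnesia.WardDefect.SchwingerDyson (hasDerivAt_exp_coe_smul hasDerivAt_reTrace)
open Summit.QuantumFields.YangMills.Theorems.EquipartitionPinsProbe.TangentSteinFiniteBeta (lipschitz_of_flow exists_abs_le_of_continuous)

namespace Summit.QuantumFields.YangMills.Theorems.TransportField

open Summit.QuantumFields.YangMills.Theorems.FemtoTransferGap

variable {L : ℕ}

/-! ## §1 One link factor -/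

/-- Print's coordinates are continuous. [cite: Balaban1985UV3, p. 260] -/
theorem continuous_su2Coord : Continuous fun x : Fin 3 → ℝ => su2Coord x := by
  refine continuous_matrix fun i j => ?_
  fin_cases i <;> fin_cases j <;> simp only [su2Coord, Matrix.of_apply, Matrix.cons_val', Matrix.empty_val',
    Matrix.cons_val_fin_one] <;> fun_prop

/-- **One link factor along the right shift**: `d/dt|₀ su2Rep(U[e ↦ U_e expPauli(t a)]_ℓ) = U_e·su2Coord(a)` if `ℓ = e`, else `0`.
[cite: Balaban1985UV3, p. 260] -/
theorem hasDerivAt_su2Rep_update_link (U : GaugeConfig 3 L SU2) (e ℓ : Edge 3 L) (a : EuclideanSpace ℝ (Fin 3)) :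
    HasDerivAt (fun t : ℝ => su2Rep (Function.update U e (U e * expPauli (t • a)) ℓ))
      (if ℓ = e then su2Rep (U e) * su2Coord (WithLp.ofLp a) else 0) 0 := by
  by_cases h : ℓ = e
  · subst h
    simp only [Function.update_self, if_true, map_mul, su2Rep_expPauli_smul]
    exact (hasDerivAt_exp_coe_smul _).const_mul _
  · simp only [Function.update_of_ne h, h, if_false]
    exact hasDerivAt_const _ _

/-! ## §2 Straight-line holonomies -/

/-- ★ **Every straight-line holonomy is differentiable along the right shift, with a continuous derivative field.**  For a continuous
direction field `a : Config → ℝ³`, a direction `k`, a length `n` and a base point `y` there is a continuous `D : Config → M₂(ℂ)` with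
`d/dt|₀ su2Rep(lineHolonomy (U[e ↦ U_e expPauli(t a(U))]) k n y) = D(U)` for every `U`. [cite: Creutz2022, Ch. 11] -/
theorem exists_hasDerivAt_lineHolonomy (e : Edge 3 L) {a : GaugeConfig 3 L SU2 → EuclideanSpace ℝ (Fin 3)} (ha : Continuous a)
    (k : Fin 3) : ∀ (n : ℕ) (y : Site 3 L), ∃ D : GaugeConfig 3 L SU2 → Matrix (Fin 2) (Fin 2) ℂ, Continuous D ∧
      ∀ U : GaugeConfig 3 L SU2,
        HasDerivAt (fun t : ℝ => su2Rep (lineHolonomy (Function.update U e (U e * expPauli (t • a U))) k n y)) (D U) 0 := by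
  intro n
  induction n with
  | zero =>
    intro y
    refine ⟨fun _ => 0, continuous_const, fun U => ?_⟩
    simp only [lineHolonomy, map_one]
    exact hasDerivAt_const _ _
  | succ n ih =>
    intro y
    obtain ⟨D', hD'c, hD'⟩ := ih (y.shift k)
    have hlink : Continuous fun U : GaugeConfig 3 L SU2 =>
        (if (y, k) = e then su2Rep (U e) * su2Coord (WithLp.ofLp (a U)) else 0 : Matrix (Fin 2) (Fin 2) ℂ) := by
      split_ifs
      · exact (continuous_su2Rep.comp (continuous_apply e)).mul
          (continuous_su2Coord.comp ((PiLp.continuous_ofLp 2 (fun _ : Fin 3 => ℝ)).comp ha))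
      · exact continuous_const
    have hhol : Continuous fun U : GaugeConfig 3 L SU2 => su2Rep (lineHolonomy U k n (y.shift k)) :=
      continuous_su2Rep.comp (continuous_lineHolonomy_apply k n (y.shift k))
    have hyk : Continuous fun U : GaugeConfig 3 L SU2 => su2Rep (U (y, k)) := continuous_su2Rep.comp (continuous_apply _)
    refine ⟨fun U => (if (y, k) = e then su2Rep (U e) * su2Coord (WithLp.ofLp (a U)) else 0) * su2Rep (lineHolonomy U k n (y.shift k)) +
        su2Rep (U (y, k)) * D' U, (hlink.mul hhol).add (hyk.mul hD'c), fun U => ?_⟩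
    have h1 := hasDerivAt_su2Rep_update_link U e (y, k) (a U)
    have h2 := hD' U
    have h := h1.mul h2
    have h0 : Function.update U e (U e * expPauli ((0 : ℝ) • a U)) = U := by
      rw [zero_smul, expPauli_zero, mul_one, Function.update_eq_self]
    simp only [h0] at h
    refine h.congr_of_eventuallyEq (Eventually.of_forall fun t => ?_)
    simp only [lineHolonomy, map_mul, Pi.mul_apply]

/-- **The direction-`0` torelon deviation `F` is differentiable along the right shift, with a continuous derivative field.**
[cite: Creutz2022, Ch. 11] -/
theorem exists_hasDerivAt_torelonDev [NeZero L] (e : Edge 3 L) {a : GaugeConfig 3 L SU2 → EuclideanSpace ℝ (Fin 3)} (ha : Continuous a) :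
    ∃ F' : GaugeConfig 3 L SU2 → ℝ, Continuous F' ∧ ∀ U : GaugeConfig 3 L SU2,
      HasDerivAt (fun t : ℝ => flowLift 0 (fun u : GaugeConfig 3 1 SU2 => 4 - ((su2Rep (u ((0 : Site 3 1), (0 : Fin 3)))).trace.re) ^ 2)
        (Function.update U e (U e * expPauli (t • a U)))) (F' U) 0 := by
  classical
  choose D hDc hD using fun y : Site 3 L => exists_hasDerivAt_lineHolonomy e ha (0 : Fin 3) L y
  refine ⟨fun U => (∑ y : Site 3 L, -(2 * (su2Rep (lineHolonomy U 0 L y)).trace.re * (D y U).trace.re)) /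
      (Fintype.card (Site 3 L) : ℝ), ?_, fun U => ?_⟩
  · refine (continuous_finsetSum _ fun y _ => ?_).div_const _
    have h1 : Continuous fun U : GaugeConfig 3 L SU2 => (su2Rep (lineHolonomy U 0 L y)).trace.re :=
      Complex.continuous_re.comp (continuous_su2Rep.comp (continuous_lineHolonomy_apply 0 L y)).matrix_trace
    have h2 : Continuous fun U : GaugeConfig 3 L SU2 => (D y U).trace.re := Complex.continuous_re.comp (hDc y).matrix_trace
    exact ((continuous_const.mul h1).mul h2).neg
  · have hsum : HasDerivAt (fun t : ℝ => ∑ y : Site 3 L,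
        (4 - ((su2Rep (lineHolonomy (Function.update U e (U e * expPauli (t • a U))) 0 L y)).trace.re) ^ 2))
        (∑ y : Site 3 L, -(2 * (su2Rep (lineHolonomy U 0 L y)).trace.re * (D y U).trace.re)) 0 := by
      refine HasDerivAt.fun_sum fun y _ => ?_
      have h := hasDerivAt_reTrace (hD y U)
      have h0 : Function.update U e (U e * expPauli ((0 : ℝ) • a U)) = U := by
        rw [zero_smul, expPauli_zero, mul_one, Function.update_eq_self]
      have hp := (h.pow 2).const_sub (4 : ℝ)
      simp only [h0] at hp
      refine hp.congr_deriv ?_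
      ring
    have h := hsum.div_const (Fintype.card (Site 3 L) : ℝ)
    refine h.congr_of_eventuallyEq (Eventually.of_forall fun t => ?_)
    simp only [flowLift, flowLiftAt, Literature.MathematicalPhysics.QuantumFieldTheory.wilsonFlow_zero, polyakovSite]

/-! ## §3 Blind direction fields: the shift is a flow and `F` is Lipschitz along it -/

/-- A straight line in direction `0` through sites whose coordinate `j ≠ 0` differs from that of `x` never meets the link `(x, 0)`. [folklore] -/
theorem lineHolonomy_update_offline (U : GaugeConfig 3 L SU2) (x : Site 3 L) (v : SU2) {j : Fin 3} (hj : j ≠ 0) :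
    ∀ (n : ℕ) (y : Site 3 L), y j ≠ x j → lineHolonomy (Function.update U (x, (0 : Fin 3)) v) 0 n y = lineHolonomy U 0 n y := by
  intro n
  induction n with
  | zero => intro y _; rfl
  | succ n ih =>
    intro y hy
    have hne : (y, (0 : Fin 3)) ≠ (x, 0) := fun h => hy (by rw [show y = x from congrArg Prod.fst h])
    have hy' : (y.shift 0) j ≠ x j := by
      rw [Site.shift, Pi.add_apply, Pi.single_apply, if_neg hj, add_zero]
      exact hy
    simp only [lineHolonomy, Function.update_of_ne hne, ih _ hy']

/-- For an `e`-blind direction field the right shift is a flow. [folklore] -/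
theorem update_expPauli_flow (e : Edge 3 L) {a : GaugeConfig 3 L SU2 → EuclideanSpace ℝ (Fin 3)}
    (hblind : ∀ (U : GaugeConfig 3 L SU2) (y : SU2), a (Function.update U e y) = a U) (s t : ℝ) (U : GaugeConfig 3 L SU2) :
    Function.update U e (U e * expPauli ((t + s) • a U)) =
      Function.update (Function.update U e (U e * expPauli (s • a U))) e
        ((Function.update U e (U e * expPauli (s • a U))) e * expPauli (t • a (Function.update U e (U e * expPauli (s • a U))))) := by
  rw [hblind, Function.update_idem, Function.update_self, mul_assoc, ← expPauli_smul_add, add_comm]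

/-- ★ **`F` is Lipschitz along the flow of an `e`-blind continuous direction field**, with the derivative field of
`exists_hasDerivAt_torelonDev` and a uniform constant. [cite: Creutz2022, Ch. 11] -/
theorem lipschitz_torelonDev_flow [NeZero L] (e : Edge 3 L) {a : GaugeConfig 3 L SU2 → EuclideanSpace ℝ (Fin 3)} (ha : Continuous a)
    (hblind : ∀ (U : GaugeConfig 3 L SU2) (y : SU2), a (Function.update U e y) = a U) :
    ∃ F' : GaugeConfig 3 L SU2 → ℝ, Continuous F' ∧ (∃ C : ℝ, 0 ≤ C ∧ (∀ U, |F' U| ≤ C) ∧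
      ∀ (U : GaugeConfig 3 L SU2) (t s : ℝ),
        |flowLift 0 (fun u : GaugeConfig 3 1 SU2 => 4 - ((su2Rep (u ((0 : Site 3 1), (0 : Fin 3)))).trace.re) ^ 2)
            (Function.update U e (U e * expPauli (t • a U))) -
          flowLift 0 (fun u : GaugeConfig 3 1 SU2 => 4 - ((su2Rep (u ((0 : Site 3 1), (0 : Fin 3)))).trace.re) ^ 2)
            (Function.update U e (U e * expPauli (s • a U)))| ≤ C * |t - s|) ∧
      ∀ U : GaugeConfig 3 L SU2,
        HasDerivAt (fun t : ℝ => flowLift 0 (fun u : GaugeConfig 3 1 SU2 => 4 - ((su2Rep (u ((0 : Site 3 1), (0 : Fin 3)))).trace.re) ^ 2)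
          (Function.update U e (U e * expPauli (t • a U)))) (F' U) 0 := by
  haveI : SecondCountableTopology SU2 := secondCountableTopology_su2
  obtain ⟨F', hF'c, hF'⟩ := exists_hasDerivAt_torelonDev e ha
  obtain ⟨C, hC0, hC⟩ := exists_abs_le_of_continuous hF'c
  refine ⟨F', hF'c, ⟨C, hC0, hC, fun U t s => ?_⟩, hF'⟩
  exact lipschitz_of_flow (fun t U => Function.update U e (U e * expPauli (t • a U))) (fun s t U => update_expPauli_flow e hblind s t U)
    _ F' hF' hC U t s

end Summit.QuantumFields.YangMills.Theorems.TransportField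

end
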